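import Mathlib
import Summits.SmoothPoincare4.SmoothPoincare4.Theorems.ShadowsStandard.Negative.TwistAbsorption

/-!
# Negative lemmas for the crux `ShadowsStandard` (item stmt-SmoothPoincare4-14593), VII:
# the EXPONENT of the mod-`e` gate (line `power-twist-absorption`)

Refuter file (drefute seat `…-14593-g2-0`); pure group theory over `TwistAbsorption.lean`.

The lead-held stub `stub_powerTwistGate` (`= ∀ m e, 2 ≤ e → GateAt m e`) asks the gate for EVERY `e ≥ 2`, while
the line's composition consumes it, for each characteristic finite-index level `M`, only at ONE exponent `e` with
`s ^ e ∈ M ∀ s` (`exists_exponent` picks `e = 2[S:M]`). Could the stub be weakened to that? NO: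

* (N9) `powerTwists_antitone_of_dvd`, `gateAt_of_dvd` — `Mod_g[e] ≤ Mod_g[e']` for `e' ∣ e`, so the gate at `e`
  implies the gate at every divisor of `e`; `forall_gateAt_iff_factorial` — the stub `↔` the gate along the
  factorials `(n+2)!`.
* (N10) `gateAt_of_forall_level` — if for every characteristic finite-index `M` SOME exponent `e` killing `S/M`
  has `GateAt m e` (the weakest form the composition `ShadowsStandard_of` can use), then `GateAt m n` holds for
  EVERY `n ≥ 1` (test level `M_{ℤ/n} = ⋂ ker (S →* ℤ/n)`, whose quotient has exponent exactly `n`: the character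
  `a₁ ↦ 1` forces `n ∣ e`, then (N9)). So the `∀ e` in the stub is not an over-statement relative to the line —
  any per-level weakening is equivalent to it — and the depth of the line is exactly the closedness of the gate
  locus under the power topology `{(A∩B)·Mod_g[e]·C}_e` of `Aut S`.
-/

noncomputable section

namespace Summit.SmoothPoincare4.SmoothPoincare4.Theorems.ShadowsStandard.Negative.PowerTwist

open Literature.Topology.FourManifolds Subgroup

/-! ## (N9) Divisibility monotonicity -/

/-- **(N9) Divisibility monotonicity**: `Mod_g[e] ≤ Mod_g[e']` for `e' ∣ e`. [folklore] -/
theorem powerTwists_antitone_of_dvd (m : ℕ) {e e' : ℕ} (h : e' ∣ e) :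
    powerTwists m e ≤ powerTwists m e' := by
  obtain ⟨k, rfl⟩ := h
  refine Subgroup.normalClosure_le_normal ?_
  rintro _ ⟨T, hT, rfl⟩
  have hmem : T ^ e' ∈ powerTwists m e' := Subgroup.subset_normalClosure ⟨T, hT, rfl⟩
  rw [SetLike.mem_coe, pow_mul]
  exact (powerTwists m e').pow_mem hmem k

/-- Hence the gate at exponent `e` implies the gate at every divisor `e'` of `e`; in particular the stub is
equivalent to the gate along any cofinal divisibility chain (e.g. `e = n!`), and the `e = 2` rung follows from
the gate at any even exponent. [folklore] -/
theorem gateAt_of_dvd {m e e' : ℕ} (h : e' ∣ e) (hG : GateAt m e) : GateAt m e' := by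
  intro K hK hK0 hK1
  obtain ⟨y, t, c, hy0, hy1, ht, hc, hK2⟩ := hG K hK hK0 hK1
  exact ⟨y, t, c, hy0, hy1, powerTwists_antitone_of_dvd m h ht, hc, hK2⟩

/-- The stub (`∀ m e, 2 ≤ e → GateAt m e`) `↔ ∀ m n, GateAt m (n+2)!` (factorials `≥ 2` are a cofinal
divisibility chain). [folklore] -/
theorem forall_gateAt_iff_factorial :
    (∀ m e : ℕ, 2 ≤ e → GateAt m e) ↔ ∀ m n : ℕ, GateAt m (Nat.factorial (n + 2)) := by
  constructor
  · intro h m n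
    exact h m _ (le_trans (by omega) (Nat.self_le_factorial (n + 2)))
  · intro h m e he
    have hd : e ∣ Nat.factorial (e - 2 + 2) := Nat.dvd_factorial (by omega) (by omega)
    exact gateAt_of_dvd hd (h m (e - 2))

/-! ## (N10) The per-level form of the gate is already the gate at every exponent -/

/-- Every element of `ℤ/n` (multiplicative notation) has `n`-th power `1`. [folklore] -/
theorem zmod_pow_self' (n : ℕ) (x : Multiplicative (ZMod n)) : x ^ n = 1 := by
  rw [← ofAdd_toAdd x, ← ofAdd_nsmul, nsmul_eq_mul, ZMod.natCast_self, zero_mul, ofAdd_zero]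

/-- **(N10)** The weakest form of the gate the line can consume — for every characteristic finite-index level
`M`, SOME exponent `e` with `s ^ e ∈ M ∀ s` has `GateAt m e` — already gives the gate at EVERY exponent `n ≥ 1`.
[folklore] -/
theorem gateAt_of_forall_level {m : ℕ}
    (h : ∀ M : Subgroup (Sg m), M.Characteristic → M.FiniteIndex →
      ∃ e : ℕ, (∀ s : Sg m, s ^ e ∈ M) ∧ GateAt m e)
    {n : ℕ} (hn : 1 ≤ n) : GateAt m n := by
  haveI : NeZero n := ⟨by omega⟩
  obtain ⟨e, he, hG⟩ := h (levelSubgroup (3 + 3 * m) (Multiplicative (ZMod n)))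
    (levelSubgroup_characteristic _ _) (levelSubgroup_finiteIndex _ _)
  refine gateAt_of_dvd ?_ hG
  -- the character `a₁ ↦ 1 ∈ ℤ/n` has order `n` on `a₁`, and `a₁ ^ e ∈ M_{ℤ/n} ≤ ker`
  let χ : Sg m →* Multiplicative (ZMod n) :=
    abelianHom fun x : surfaceGen (3 + 3 * m) =>
      if x = (h0 m, false) then Multiplicative.ofAdd (1 : ZMod n) else 1
  have h1 : χ (PresentedGroup.of (h0 m, false)) = Multiplicative.ofAdd (1 : ZMod n) := by
    simp [χ]
  have h2 : (PresentedGroup.of (h0 m, false) : Sg m) ^ e ∈ χ.ker := levelSubgroup_le_ker χ (he _)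
  rw [MonoidHom.mem_ker, map_pow, h1, ← ofAdd_nsmul, nsmul_eq_mul, mul_one, ofAdd_eq_one,
    ZMod.natCast_eq_zero_iff] at h2
  exact h2

/-- Hence, over all levels, "some killing exponent passes the gate" is EQUIVALENT to "every exponent `≥ 1` passes
the gate" (the converse direction takes `e = [S:M]`-type exponents: `Subgroup.pow_index_mem`). [folklore] -/
theorem forall_level_iff_forall_gateAt (m : ℕ) :
    (∀ M : Subgroup (Sg m), M.Characteristic → M.FiniteIndex →
      ∃ e : ℕ, (∀ s : Sg m, s ^ e ∈ M) ∧ GateAt m e) ↔ ∀ n : ℕ, 1 ≤ n → GateAt m n := by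
  constructor
  · intro h n hn
    exact gateAt_of_forall_level h hn
  · intro h M _ hMf
    refine ⟨M.index, fun s => M.pow_index_mem s, h _ ?_⟩
    exact Nat.one_le_iff_ne_zero.2 hMf.index_ne_zero

end Summit.SmoothPoincare4.SmoothPoincare4.Theorems.ShadowsStandard.Negative.PowerTwist

end
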